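import Summits.HodgeConjecture.HodgeConjecture.Theorems.F0P3cStCharTSCartanEllProd   -- ★ (this seat) «CARTAN-ELL-PROD★»: §4 transport `A → A × B`, §5 NORMAL FORM
import Literature.NumberTheory.Rogawski1990.LocalCentralizerTorusMeasureCM               -- ★ `isRegularElt_fst_snd_of_isLocalGRegular`, `IsLocalGRegular` (via `LocalTransfer`)
import Literature.NumberTheory.Rogawski1990.LocalTransferUnmatchedLocus                  -- ★ `compactSpace_cmDatum_local_one_of_smul_eq` (`U(Φ₁)(L⁺_v)` compact at non-split `v`)
import Literature.NumberTheory.Automorphic.AnisotropicUnitaryGroupCompactOfPlace         -- ★ `conjLocal_apply_eq_of_smul_eq` (`(c ⊗ 1) y` read at the unique `w ∣ v`)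
import Literature.NumberTheory.Automorphic.UnitaryGroupBorelInduction                    -- ★ `normOneUnits`, `quotConj`, `conjLocal_conjLocal_cm`
import HarnessLib

/-!
# F0 · P3c · line LH6 «StCharTS» — «CARTAN-ELL-H ⟸ CARTAN-FIN at rank 2»: the (P5) ∃-fact «CARTAN-ELL-H» of the §12.5 datum road from finitely many
# conjugacy classes of Cartan subgroups of `U(Φ₂)(L⁺_v)` (the `G`-regular completion sentence PROVED here)

Cell `pub/hodgecm-mathlib`, FLOOR 0, crux H413 = stmt-HodgeConjecture-24833, SUPPORTS-ONLY lane
(`--kind proof --supports stmt-HodgeConjecture-24833 --as helper`), prover seat F0P2-p01 (g22), 2026-09-02 (NAMED on the F0∕P2 + F0∕P3b + F0∕P3a buses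
14:17Z; map row MAP-DATUM-ROAD v5 §3 `cartanH μTH`: «CARTAN-ELL-H ∃-fact (pins (P5)) — RUNG0 HYPOTHESIS (print §3.6∕§12.5)»).  THEOREMS ONLY; ★-only imports.
Touches no registry and no served Line; count-neutral.

THE STATEMENT.  `H_v = U(Φ₂)(L⁺_v) × U(Φ₁)(L⁺_v)` at a finite place `v` of `L⁺` that does not split in the CM field `L` (`hns`).  The conclusion of
`cartanEllH_of_cartanFin_two` is the hypothesis `hCartEllH` of ★ p851472 `F0P3cStCharTSHFields.cartanH_pins_of_cartanEllH` VERBATIM: a finite set `SH` of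
COMPACT Cartan subgroups `Z_H(γ₀)`, `γ₀` `G`-regular (★ `IsLocalGRegular`), each with a Haar PROBABILITY measure `μTHf T` (print's «meas = 1» [Rogawski1990,
§12.5 p. 184]), COMPLETE up to `H_v`-conjugacy among the compact `Z_H(γ₀)` (`γ₀` `G`-regular) and pairwise NON-conjugate.  The hypotheses are exactly:
* (r1) `hfin2` — «finitely many `U(Φ₂)(L⁺_v)`-conjugacy classes of Cartan subgroups `Z(a)`, `a` regular semisimple» in the TWO-clause shape of the in-house
  road CARTAN-FIN (N1) (F0P3a-p03 (g24); ★ p851679 `Rogawski1990/UnitaryCartanClassesFinite :: exists_finset_cartanSubgroups_of_types_of_norms` concludes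
  this shape on the one-place model for every rank `N`; the rank-2 transport to the `cmDatum` carrier is that road's (B7b) pattern) [Rogawski1990, §3.6;
  PlatonovRapinchuk1994, §6.4];
  — the ONLY hypothesis besides `hns`.
Discharged IN this file: (r3) the «`G`-REGULAR COMPLETION» sentence — every regular semisimple `a ∈ U(Φ₂)(L⁺_v)` has a partner `b ∈ U(Φ₁)(L⁺_v)`
with `(a, b)` `G`-regular (`χ_{ι(a,b)} = χ_a · (X − b)` [Rogawski1990, §4.3 p. 42], ★ `charpoly_endoGL`): per place `w ∣ v` one of the three norm quotients
`1`, `ℓ ∕ ℓ̄`, `(1 + ℓ) ∕ (1 + ℓ̄)` (`ℓ ∈ L` moved by complex conjugation; they are pairwise distinct) misses the at most two roots of `(χ_a)_w`; the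
assembled `z ∈ (∏_{w∣v} L_w)ˣ` gives the norm-one unit `u = z ∕ z̄` (★ `quotConj`) with `χ_a(u)` a unit, whence `IsCoprime χ_a (X − u)` and `(a, (u))` is
`G`-regular (§§1–3); (r2) `U(Φ₁)(L⁺_v)` is COMPACT at non-split `v` (★ `compactSpace_cmDatum_local_one_of_smul_eq`) and COMMUTATIVE (the `1 × 1` matrix
computation, inline; ★ `local_one_comm` states it at split places only); «`G`-regular ⇒ first component regular» is ★ `isRegularElt_fst_snd_of_isLocalGRegular`.  Proof of the head = ★ CARTAN-ELL-PROD §5 NORMAL FORM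
(`exists_cartanEll_of_finite_classes`) on `U(Φ₂)(L⁺_v)`, then §4 `exists_cartanEll_prod_of_cartanEll_haar` with `B := U(Φ₁)(L⁺_v)`.

* §1 pure algebra: `isCoprime_X_sub_C_of_isUnit_eval`, `charpoly_fin_one`, `exists_not_isRoot_of_three`, `three_distinct_quotients`.
* §2 `exists_normOne_isUnit_eval` — at non-split `v`, for `p ∈ (∏ L_w)[X]` with non-zero components of `natDegree ≤ 2` a NORM-ONE unit `u` with `p(u)` a unit.
* §3 `exists_isLocalGRegular` — the `G`-regular completion.
* §4 **`cartanEllH_of_cartanFin_two`** — THE HEAD; `cartanEllH_of_cartanFin_two_measureFree` — the same three clauses without the measures.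

HONEST LABEL: HC_CM is proved only modulo the 7 printed citations (2 remaining named inputs: hLiu418 = stmt-HodgeConjecture-24832,
h413 = stmt-HodgeConjecture-24833) until rung 0 closes; this file pays the H-side RUNG0 hypothesis together with (r1) = the CARTAN-FIN road at rank 2.

## References
* [Rogawski1990] J. D. Rogawski, *Automorphic Representations of Unitary Groups in Three Variables*, Ann. of Math. Stud. 123 (1990):
  §3.6 pp. 28–31 (Cartan subgroups of `U(2) × U(1)` and `U(3)`), §4.3 p. 42 (`G`-regular elements of `H`), §12.5 p. 184 (elliptic tori of `H`, normalised measures).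
* [PlatonovRapinchuk1994] V. Platonov, A. Rapinchuk, *Algebraic Groups and Number Theory* (1994), §6.2 (`U(1)` compact at a non-split place), §6.4
  (finiteness of conjugacy classes of tori over local fields).
-/

set_option autoImplicit false
-- the mandated namespace repeats `HodgeConjecture.HodgeConjecture`, as in every `Theorems/*.lean` of this sub-problem
set_option linter.dupNamespace false

noncomputable section

namespace Summit.HodgeConjecture.HodgeConjecture.Cruxes.H413.F0P3cStCharTSCartanEllH

open MeasureTheory NumberField IsDedekindDomain Polynomial
open scoped Matrix MatrixGroups
open Literature.NumberTheory.Rogawski1990 Literature.NumberTheory.Automorphic Literature.NumberTheory.Automorphic.UnitaryGroup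
open Summit.HodgeConjecture.HodgeConjecture.Cruxes.H413.F0P3cStCharTSCartanEllProd


/-! ## §1 Pure algebra: coprimality from a unit value, `1 × 1` characteristic polynomials, three candidates -/

/-- If `p(u)` is a unit then `p` and `X − u` are coprime. [folklore] -/
theorem isCoprime_X_sub_C_of_isUnit_eval {R : Type*} [CommRing R] (p : R[X]) (u : R) (h : IsUnit (p.eval u)) :
    IsCoprime p (X - C u) := by
  obtain ⟨w, hw⟩ := h
  have hdiv := modByMonic_add_div p (X - C u)
  rw [modByMonic_X_sub_C_eq_C_eval] at hdiv
  -- `p = C (p.eval u) + (X - C u) * q`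
  refine ⟨C (↑w⁻¹ : R), -(C (↑w⁻¹ : R) * (p /ₘ (X - C u))), ?_⟩
  have : C (↑w⁻¹ : R) * C (p.eval u) = 1 := by rw [← C_mul, ← hw, Units.inv_mul, C_1]
  calc C (↑w⁻¹ : R) * p + -(C (↑w⁻¹ : R) * (p /ₘ (X - C u))) * (X - C u)
      = C (↑w⁻¹ : R) * (C (p.eval u) + (X - C u) * (p /ₘ (X - C u))) + -(C (↑w⁻¹ : R) * (p /ₘ (X - C u))) * (X - C u) := by rw [hdiv]
    _ = 1 := by rw [mul_add, this]; ring

/-- The characteristic polynomial of a `1 × 1` matrix. [folklore] -/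
theorem charpoly_fin_one {R : Type*} [CommRing R] (M : Matrix (Fin 1) (Fin 1) R) : M.charpoly = X - C (M 0 0) := by
  rw [Matrix.charpoly, Matrix.det_fin_one, Matrix.charmatrix_apply_eq]

/-- In a domain, a monic polynomial of degree `2`... any nonzero polynomial of `natDegree ≤ 2` cannot have three distinct roots. [folklore] -/
theorem exists_not_isRoot_of_three {K : Type*} [CommRing K] [IsDomain K] (p : K[X]) (hp : p ≠ 0) (hdeg : p.natDegree ≤ 2)
    (a b c : K) (hab : a ≠ b) (hac : a ≠ c) (hbc : b ≠ c) : ¬ p.IsRoot a ∨ ¬ p.IsRoot b ∨ ¬ p.IsRoot c := by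
  by_contra h
  simp only [not_or, not_not] at h
  obtain ⟨ha, hb, hc⟩ := h
  have hnd : ({a, b, c} : Multiset K).Nodup := by simp [hab, hac, hbc]
  have hsub : ({a, b, c} : Multiset K) ≤ p.roots := by
    rw [Multiset.le_iff_subset hnd]
    intro x hx
    simp only [Multiset.insert_eq_cons, Multiset.mem_cons, Multiset.mem_singleton] at hx
    rw [mem_roots hp]
    rcases hx with rfl | rfl | rfl <;> assumption
  have := (Multiset.card_le_card hsub).trans ((card_roots' p).trans hdeg)
  simp at this


/-- Three pairwise distinct «norm quotients» `1`, `t ∕ t'`, `(1 + t) ∕ (1 + t')` from `t ≠ t'`, `t' ≠ 0`, `1 + t' ≠ 0`. [folklore] -/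
theorem three_distinct_quotients {K : Type*} [Field K] {t t' : K} (htt : t ≠ t') (ht' : t' ≠ 0) (h1t' : 1 + t' ≠ 0) :
    (1 : K) ≠ t / t' ∧ (1 : K) ≠ (1 + t) / (1 + t') ∧ t / t' ≠ (1 + t) / (1 + t') := by
  refine ⟨fun h => htt ?_, fun h => htt ?_, fun h => htt ?_⟩
  · rw [eq_div_iff ht', one_mul] at h; exact h.symm
  · rw [eq_div_iff h1t', one_mul] at h; exact (add_left_cancel h).symm
  · rw [div_eq_div_iff ht' h1t'] at h
    -- `t * (1 + t') = (1 + t) * t'`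
    have : t = t' := by linear_combination h
    exact this

/-! ## §2 Norm-one units of `L ⊗ L⁺_v` with prescribed non-vanishing, at a non-split place -/

variable (L : Type) [Field L] [NumberField L] [IsCMField L] (v : HeightOneSpectrum (𝓞 ↥(maximalRealSubfield L)))

/-- **At a non-split `v`, for every `p ∈ (L ⊗ L⁺_v)[X]` whose components have `natDegree ≤ 2` and are non-zero there is a NORM-ONE unit `u`
(`ū u = 1`) with `p(u)` a unit.**  Per place `w ∣ v` one of the three norm quotients `1`, `θ ∕ θ̄`, `(1+θ) ∕ (1+θ̄)` (`θ ∈ L`, `θ̄ ≠ θ`)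
misses the at most two roots of `p_w`. [cite: Rogawski1990, §3.6 pp. 30–31] -/
theorem exists_normOne_isUnit_eval (hns : ∀ w : PlacesOver L v, IsCMField.complexConj L • w.1 = w.1)
    (p : (UnitaryGroup.LocalRing L v)[X])
    (hp : ∀ w : PlacesOver L v, p.map (Pi.evalRingHom (fun w : PlacesOver L v => w.1.adicCompletion L) w) ≠ 0 ∧
      (p.map (Pi.evalRingHom (fun w : PlacesOver L v => w.1.adicCompletion L) w)).natDegree ≤ 2) :
    ∃ u : (UnitaryGroup.LocalRing L v)ˣ,
      conjLocal L (IsCMField.complexConj L) v (u : UnitaryGroup.LocalRing L v) * (u : UnitaryGroup.LocalRing L v) = 1 ∧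
        IsUnit (p.eval (u : UnitaryGroup.LocalRing L v)) := by
  classical
  haveI : Algebra.IsQuadraticExtension ↥(maximalRealSubfield L) L := IsCMField.isQuadraticExtension L
  -- a global `ℓ` moved by complex conjugation
  obtain ⟨ℓ, hℓ⟩ : ∃ e : L, IsCMField.complexConj L e ≠ e := by
    by_contra h
    exact IsCMField.complexConj_ne_one L (AlgEquiv.ext fun x => not_ne_iff.mp (not_exists.mp h x))
  -- per place `w`: one of the three candidates `1`, `ℓ`, `1 + ℓ` has norm quotient off the roots of `p_w`
  have key : ∀ w : PlacesOver L v, ∃ z : w.1.adicCompletion L, z ≠ 0 ∧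
      galAdicCompletionMap (L := L) (IsCMField.complexConj L) (hns w) z ≠ 0 ∧
      ¬ (p.map (Pi.evalRingHom (fun w : PlacesOver L v => w.1.adicCompletion L) w)).IsRoot
        (z / galAdicCompletionMap (L := L) (IsCMField.complexConj L) (hns w) z) := by
    intro w
    have hcoe : ∀ x : L, ((x : L) : w.1.adicCompletion L) = algebraMap L (w.1.adicCompletion L) x := fun x => by
      rw [IsDedekindDomain.HeightOneSpectrum.algebraMap_adicCompletion]; rfl
    have hinj : ∀ x y : L, ((x : L) : w.1.adicCompletion L) = ((y : L) : w.1.adicCompletion L) → x = y := by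
      intro x y hxy
      rw [hcoe, hcoe] at hxy
      exact (algebraMap L (w.1.adicCompletion L)).injective hxy
    have hσx : ∀ x : L, galAdicCompletionMap (L := L) (IsCMField.complexConj L) (hns w) ((x : L) : w.1.adicCompletion L) =
        ((IsCMField.complexConj L x : L) : w.1.adicCompletion L) :=
      fun x => galAdicCompletionMap_coe_algEquiv (↥(maximalRealSubfield L)) (IsCMField.complexConj L) (hns w) x
    have h0 : ((0 : L) : w.1.adicCompletion L) = 0 := by rw [hcoe, map_zero]
    have hm1 : (((-1 : L)) : w.1.adicCompletion L) = -1 := by rw [hcoe, map_neg, map_one]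
    -- `ℓ ≠ 0`, `ℓ ≠ -1`, since those are fixed by conjugation
    have hℓ0 : ℓ ≠ 0 := fun h => hℓ (by rw [h, map_zero])
    have hℓ1 : ℓ ≠ -1 := fun h => hℓ (by rw [h, map_neg, map_one])
    have hcℓ0 : IsCMField.complexConj L ℓ ≠ 0 := fun h => hℓ0 (by
      have := congrArg (IsCMField.complexConj L) h
      rwa [IsCMField.complexConj_apply_apply, map_zero] at this)
    have hcℓ1 : IsCMField.complexConj L ℓ ≠ -1 := fun h => hℓ1 (by
      have := congrArg (IsCMField.complexConj L) h
      rwa [IsCMField.complexConj_apply_apply, map_neg, map_one] at this)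
    -- the two field elements `t = ℓ`, `t' = ℓ̄` in `L_w`
    have htt : ((ℓ : L) : w.1.adicCompletion L) ≠ ((IsCMField.complexConj L ℓ : L) : w.1.adicCompletion L) :=
      fun h => hℓ (hinj _ _ h).symm
    have ht0 : ((ℓ : L) : w.1.adicCompletion L) ≠ 0 := fun h => hℓ0 (hinj _ _ (h.trans h0.symm))
    have ht'0 : ((IsCMField.complexConj L ℓ : L) : w.1.adicCompletion L) ≠ 0 := fun h => hcℓ0 (hinj _ _ (h.trans h0.symm))
    have h1t : 1 + ((ℓ : L) : w.1.adicCompletion L) ≠ 0 := fun h =>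
      hℓ1 (hinj _ _ ((eq_neg_of_add_eq_zero_right h).trans hm1.symm))
    have h1t' : 1 + ((IsCMField.complexConj L ℓ : L) : w.1.adicCompletion L) ≠ 0 := fun h =>
      hcℓ1 (hinj _ _ ((eq_neg_of_add_eq_zero_right h).trans hm1.symm))
    obtain ⟨h01, h02, h12⟩ := three_distinct_quotients htt ht'0 h1t'
    rcases exists_not_isRoot_of_three _ (hp w).1 (hp w).2 _ _ _ h01 h02 h12 with h | h | h
    · refine ⟨1, one_ne_zero, by rw [map_one]; exact one_ne_zero, ?_⟩
      rwa [map_one, div_one]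
    · refine ⟨((ℓ : L) : w.1.adicCompletion L), ht0, by rw [hσx]; exact ht'0, ?_⟩
      rwa [hσx]
    · refine ⟨1 + ((ℓ : L) : w.1.adicCompletion L), h1t, by rw [map_add, map_one, hσx]; exact h1t', ?_⟩
      rwa [map_add, map_one, hσx]
  choose z hz0 hσz0 hzroot using key
  -- assemble `z ∈ (∏ L_w)ˣ` and `u := z ∕ z̄`
  have hzU : IsUnit (fun w => z w : UnitaryGroup.LocalRing L v) := Pi.isUnit_iff.mpr fun w => isUnit_iff_ne_zero.mpr (hz0 w)
  have hσ2 := conjLocal_conjLocal_cm L v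
  refine ⟨(quotConj (conjLocal L (IsCMField.complexConj L) v) hσ2 hzU.unit : ↥(normOneUnits (conjLocal L (IsCMField.complexConj L) v))),
    (mem_normOneUnits_iff _).1 (quotConj _ hσ2 hzU.unit).2, ?_⟩
  rw [Pi.isUnit_iff]
  intro w
  rw [isUnit_iff_ne_zero]
  -- the `w`-component of `u` is `z_w ∕ σ_w z_w`
  have hcomp : (((quotConj (conjLocal L (IsCMField.complexConj L) v) hσ2 hzU.unit :
        ↥(normOneUnits (conjLocal L (IsCMField.complexConj L) v))) : (UnitaryGroup.LocalRing L v)ˣ) : UnitaryGroup.LocalRing L v) w =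
      z w / galAdicCompletionMap (L := L) (IsCMField.complexConj L) (hns w) (z w) := by
    rw [coe_quotConj, Units.val_mul, Units.val_inv_eq_inv_val, Pi.mul_apply, Pi.inv_apply, Units.coe_map, MonoidHom.coe_coe,
      IsUnit.unit_spec, conjLocal_apply_eq_of_smul_eq (IsCMField.complexConj L) (IsCMField.complexConj_ne_one L) v w (hns w),
      div_eq_mul_inv]
  have heval : (p.eval (((quotConj (conjLocal L (IsCMField.complexConj L) v) hσ2 hzU.unit :
        ↥(normOneUnits (conjLocal L (IsCMField.complexConj L) v))) : (UnitaryGroup.LocalRing L v)ˣ) : UnitaryGroup.LocalRing L v)) w =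
      (p.map (Pi.evalRingHom (fun w : PlacesOver L v => w.1.adicCompletion L) w)).eval
        (z w / galAdicCompletionMap (L := L) (IsCMField.complexConj L) (hns w) (z w)) := by
    rw [← hcomp, eval_map]
    exact (eval₂_at_apply (Pi.evalRingHom (fun w : PlacesOver L v => w.1.adicCompletion L) w) _).symm
  rw [heval]
  exact hzroot w

/-! ## §3 The `G`-regular completion (residual (r3) of the bus census — DISCHARGED) -/

/-- **«`G`-REGULAR COMPLETION»**: at a non-split place `v`, every regular semisimple `a ∈ U(Φ₂)(L⁺_v)` has a partner `b ∈ U(Φ₁)(L⁺_v)` with `(a, b)`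
`G`-regular in `H_v = U(Φ₂)(L⁺_v) × U(Φ₁)(L⁺_v)` (`χ_{ι(a,b)} = χ_a · (X − b)`, ★ `charpoly_endoGL`; take `b = (u)` the norm-one scalar of §2 with
`χ_a(u)` a unit). [cite: Rogawski1990, §4.3 p. 42; §3.6 pp. 30–31] -/
theorem exists_isLocalGRegular (hns : ∀ w : PlacesOver L v, IsCMField.complexConj L • w.1 = w.1)
    (a : (UnitaryGroup.cmDatum L 2 (Matrix.of fun i j : Fin 2 => if i.val + j.val + 1 = 2 then (1 : L) else 0)).Local v)
    (ha : IsRegularElt (a.val : GL (Fin 2) (UnitaryGroup.LocalRing L v))) :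
    ∃ b : (UnitaryGroup.cmDatum L 1 (Matrix.of fun i j : Fin 1 => if i.val + j.val + 1 = 1 then (1 : L) else 0)).Local v,
      IsLocalGRegular L v (a, b) := by
  classical
  have hp : ∀ w : PlacesOver L v,
      (((a.val : GL (Fin 2) (UnitaryGroup.LocalRing L v)) : Matrix (Fin 2) (Fin 2) (UnitaryGroup.LocalRing L v)).charpoly).map
          (Pi.evalRingHom (fun w : PlacesOver L v => w.1.adicCompletion L) w) ≠ 0 ∧
      ((((a.val : GL (Fin 2) (UnitaryGroup.LocalRing L v)) : Matrix (Fin 2) (Fin 2) (UnitaryGroup.LocalRing L v)).charpoly).map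
          (Pi.evalRingHom (fun w : PlacesOver L v => w.1.adicCompletion L) w)).natDegree ≤ 2 := by
    intro w
    rw [← Matrix.charpoly_map]
    exact ⟨(Matrix.charpoly_monic _).ne_zero, (Matrix.charpoly_natDegree_eq_dim _).le.trans (by simp)⟩
  obtain ⟨u, hu, hunit⟩ := exists_normOne_isUnit_eval L v hns _ hp
  have hg : Units.map (Matrix.scalar (Fin 1) : UnitaryGroup.LocalRing L v →+* Matrix (Fin 1) (Fin 1) (UnitaryGroup.LocalRing L v)).toMonoidHom u ∈
      «local» L (IsCMField.complexConj L) 1 (Matrix.of fun i j : Fin 1 => if i.val + j.val + 1 = 1 then (1 : L) else 0) v :=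
    scalar_mem_unitaryGroupOfForm (conjLocal L (IsCMField.complexConj L) v) _ u hu
  refine ⟨⟨_, hg⟩, ?_⟩
  show IsRegularElt ((endoEmbLocal L v (a, ⟨_, hg⟩)).val : GL (Fin 3) (UnitaryGroup.LocalRing L v))
  rw [isRegularElt_iff, coe_endoEmbLocal, charpoly_endoGL]
  have hb : ((Units.map (Matrix.scalar (Fin 1) : UnitaryGroup.LocalRing L v →+* Matrix (Fin 1) (Fin 1) (UnitaryGroup.LocalRing L v)).toMonoidHom u :
      GL (Fin 1) (UnitaryGroup.LocalRing L v)) : Matrix (Fin 1) (Fin 1) (UnitaryGroup.LocalRing L v)).charpoly =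
      X - C (u : UnitaryGroup.LocalRing L v) := by
    rw [charpoly_fin_one, Units.coe_map]
    change X - C ((Matrix.scalar (Fin 1) (u : UnitaryGroup.LocalRing L v)) 0 0) = _
    rw [Matrix.scalar_apply, Matrix.diagonal_apply_eq]
  rw [hb]
  exact ((isRegularElt_iff _).mp ha).mul separable_X_sub_C (isCoprime_X_sub_C_of_isUnit_eval _ _ hunit)


/-! ## §4 The (P5) ∃-fact from CARTAN-FIN at rank 2 (`U(Φ₁)(L⁺_v)` is commutative: `1 × 1` matrices over the commutative `∏ L_w`, proved inline) -/

/-- **CARTAN-ELL-H, measure-free three clauses, from CARTAN-FIN at rank 2** (non-split `v`; the `G`-regular completion is §3): NORMAL FORM on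
`U(Φ₂)(L⁺_v)` (★ `exists_cartanEll_of_finite_classes`) then the product transport (★ `exists_cartanEll_prod_of_cartanEll`) with the compact commutative
factor `U(Φ₁)(L⁺_v)`. [cite: Rogawski1990, §3.6 pp. 28–31; §4.3 p. 42] [cite: PlatonovRapinchuk1994, §6.2, §6.4] -/
theorem cartanEllH_of_cartanFin_two_measureFree
    (hns : ∀ w : PlacesOver L v, IsCMField.complexConj L • w.1 = w.1)
    (hfin2 : ∃ S : Finset (Subgroup ((UnitaryGroup.cmDatum L 2 (Matrix.of fun i j : Fin 2 => if i.val + j.val + 1 = 2 then (1 : L) else 0)).Local v)),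
      (∀ T ∈ S, ∃ a₀ : (UnitaryGroup.cmDatum L 2 (Matrix.of fun i j : Fin 2 => if i.val + j.val + 1 = 2 then (1 : L) else 0)).Local v, IsRegularElt (a₀.val : GL (Fin 2) (UnitaryGroup.LocalRing L v)) ∧ T = Subgroup.centralizer ({a₀} : Set ((UnitaryGroup.cmDatum L 2 (Matrix.of fun i j : Fin 2 => if i.val + j.val + 1 = 2 then (1 : L) else 0)).Local v))) ∧
      ∀ a : (UnitaryGroup.cmDatum L 2 (Matrix.of fun i j : Fin 2 => if i.val + j.val + 1 = 2 then (1 : L) else 0)).Local v, IsRegularElt (a.val : GL (Fin 2) (UnitaryGroup.LocalRing L v)) →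
        ∃ T ∈ S, ∃ u : (UnitaryGroup.cmDatum L 2 (Matrix.of fun i j : Fin 2 => if i.val + j.val + 1 = 2 then (1 : L) else 0)).Local v, Subgroup.centralizer ({a} : Set ((UnitaryGroup.cmDatum L 2 (Matrix.of fun i j : Fin 2 => if i.val + j.val + 1 = 2 then (1 : L) else 0)).Local v)) = T.map (MulAut.conj u).toMonoidHom) :
    ∃ SH : Finset (Subgroup ((UnitaryGroup.cmDatum L 2 (Matrix.of fun i j : Fin 2 => if i.val + j.val + 1 = 2 then (1 : L) else 0)).Local v ×
        (UnitaryGroup.cmDatum L 1 (Matrix.of fun i j : Fin 1 => if i.val + j.val + 1 = 1 then (1 : L) else 0)).Local v)),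
      (∀ T ∈ SH, IsCompact (T : Set ((UnitaryGroup.cmDatum L 2 (Matrix.of fun i j : Fin 2 => if i.val + j.val + 1 = 2 then (1 : L) else 0)).Local v ×
        (UnitaryGroup.cmDatum L 1 (Matrix.of fun i j : Fin 1 => if i.val + j.val + 1 = 1 then (1 : L) else 0)).Local v)) ∧
        ∃ γ₀ : (UnitaryGroup.cmDatum L 2 (Matrix.of fun i j : Fin 2 => if i.val + j.val + 1 = 2 then (1 : L) else 0)).Local v ×
        (UnitaryGroup.cmDatum L 1 (Matrix.of fun i j : Fin 1 => if i.val + j.val + 1 = 1 then (1 : L) else 0)).Local v, IsLocalGRegular L v γ₀ ∧ T = Subgroup.centralizer ({γ₀} : Set ((UnitaryGroup.cmDatum L 2 (Matrix.of fun i j : Fin 2 => if i.val + j.val + 1 = 2 then (1 : L) else 0)).Local v ×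
        (UnitaryGroup.cmDatum L 1 (Matrix.of fun i j : Fin 1 => if i.val + j.val + 1 = 1 then (1 : L) else 0)).Local v))) ∧
      (∀ γ₀ : (UnitaryGroup.cmDatum L 2 (Matrix.of fun i j : Fin 2 => if i.val + j.val + 1 = 2 then (1 : L) else 0)).Local v ×
        (UnitaryGroup.cmDatum L 1 (Matrix.of fun i j : Fin 1 => if i.val + j.val + 1 = 1 then (1 : L) else 0)).Local v, IsLocalGRegular L v γ₀ →
        IsCompact ((Subgroup.centralizer ({γ₀} : Set ((UnitaryGroup.cmDatum L 2 (Matrix.of fun i j : Fin 2 => if i.val + j.val + 1 = 2 then (1 : L) else 0)).Local v ×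
        (UnitaryGroup.cmDatum L 1 (Matrix.of fun i j : Fin 1 => if i.val + j.val + 1 = 1 then (1 : L) else 0)).Local v)) : Subgroup ((UnitaryGroup.cmDatum L 2 (Matrix.of fun i j : Fin 2 => if i.val + j.val + 1 = 2 then (1 : L) else 0)).Local v ×
        (UnitaryGroup.cmDatum L 1 (Matrix.of fun i j : Fin 1 => if i.val + j.val + 1 = 1 then (1 : L) else 0)).Local v)) : Set ((UnitaryGroup.cmDatum L 2 (Matrix.of fun i j : Fin 2 => if i.val + j.val + 1 = 2 then (1 : L) else 0)).Local v ×
        (UnitaryGroup.cmDatum L 1 (Matrix.of fun i j : Fin 1 => if i.val + j.val + 1 = 1 then (1 : L) else 0)).Local v)) →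
        ∃ T ∈ SH, ∃ x : (UnitaryGroup.cmDatum L 2 (Matrix.of fun i j : Fin 2 => if i.val + j.val + 1 = 2 then (1 : L) else 0)).Local v ×
        (UnitaryGroup.cmDatum L 1 (Matrix.of fun i j : Fin 1 => if i.val + j.val + 1 = 1 then (1 : L) else 0)).Local v, Subgroup.centralizer ({x * γ₀ * x⁻¹} : Set ((UnitaryGroup.cmDatum L 2 (Matrix.of fun i j : Fin 2 => if i.val + j.val + 1 = 2 then (1 : L) else 0)).Local v ×
        (UnitaryGroup.cmDatum L 1 (Matrix.of fun i j : Fin 1 => if i.val + j.val + 1 = 1 then (1 : L) else 0)).Local v)) = T) ∧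
      (∀ T ∈ SH, ∀ T' ∈ SH, (∃ x : (UnitaryGroup.cmDatum L 2 (Matrix.of fun i j : Fin 2 => if i.val + j.val + 1 = 2 then (1 : L) else 0)).Local v ×
        (UnitaryGroup.cmDatum L 1 (Matrix.of fun i j : Fin 1 => if i.val + j.val + 1 = 1 then (1 : L) else 0)).Local v, T.map (MulAut.conj x).toMonoidHom = T') → T = T') := by
  have hcomm : ∀ a b : (UnitaryGroup.cmDatum L 1 (Matrix.of fun i j : Fin 1 => if i.val + j.val + 1 = 1 then (1 : L) else 0)).Local v, a * b = b * a := by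
    intro a b
    apply Subtype.ext
    apply Units.ext
    change (a.val : GL (Fin 1) (UnitaryGroup.LocalRing L v)).val * (b.val : GL (Fin 1) (UnitaryGroup.LocalRing L v)).val =
      (b.val : GL (Fin 1) (UnitaryGroup.LocalRing L v)).val * (a.val : GL (Fin 1) (UnitaryGroup.LocalRing L v)).val
    ext i j
    obtain rfl : i = 0 := Subsingleton.elim _ _
    obtain rfl : j = 0 := Subsingleton.elim _ _
    simp only [Matrix.mul_apply, Fin.sum_univ_one]
    exact mul_comm _ _
  obtain ⟨w⟩ : Nonempty (PlacesOver L v) := inferInstance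
  haveI : CompactSpace ((UnitaryGroup.cmDatum L 1 (Matrix.of fun i j : Fin 1 => if i.val + j.val + 1 = 1 then (1 : L) else 0)).Local v) := compactSpace_cmDatum_local_one_of_smul_eq L v w (hns w)
  exact exists_cartanEll_prod_of_cartanEll (A := (UnitaryGroup.cmDatum L 2 (Matrix.of fun i j : Fin 2 => if i.val + j.val + 1 = 2 then (1 : L) else 0)).Local v) (B := (UnitaryGroup.cmDatum L 1 (Matrix.of fun i j : Fin 1 => if i.val + j.val + 1 = 1 then (1 : L) else 0)).Local v) hcomm
    (RegA := fun a => IsRegularElt (a.val : GL (Fin 2) (UnitaryGroup.LocalRing L v))) (Reg := IsLocalGRegular L v)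
    (fun γ hγ => (isRegularElt_fst_snd_of_isLocalGRegular L v γ hγ).1) (exists_isLocalGRegular L v hns) (exists_cartanEll_of_finite_classes hfin2)

/-- **CARTAN-ELL-H ⟸ CARTAN-FIN at rank 2.**  At a non-split finite place `v`, given (r1) finitely many `U(Φ₂)(L⁺_v)`-conjugacy classes of Cartan subgroups
`Z(a)`, `a` regular semisimple (two-clause road shape), the (P5) «CARTAN-ELL-H» ∃-fact holds — the conclusion
is the hypothesis `hCartEllH` of ★ `F0P3cStCharTSHFields.cartanH_pins_of_cartanEllH` VERBATIM (compact `Z_H(γ₀)` representatives, `γ₀` `G`-regular, Haar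
PROBABILITY measures, completeness, pairwise non-conjugacy). [cite: Rogawski1990, §3.6 pp. 28–31; §12.5 p. 184] [cite: PlatonovRapinchuk1994, §6.2, §6.4] -/
theorem cartanEllH_of_cartanFin_two
    [MeasurableSpace ((UnitaryGroup.cmDatum L 2 (Matrix.of fun i j : Fin 2 => if i.val + j.val + 1 = 2 then (1 : L) else 0)).Local v ×
        (UnitaryGroup.cmDatum L 1 (Matrix.of fun i j : Fin 1 => if i.val + j.val + 1 = 1 then (1 : L) else 0)).Local v)]
    [BorelSpace ((UnitaryGroup.cmDatum L 2 (Matrix.of fun i j : Fin 2 => if i.val + j.val + 1 = 2 then (1 : L) else 0)).Local v ×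
        (UnitaryGroup.cmDatum L 1 (Matrix.of fun i j : Fin 1 => if i.val + j.val + 1 = 1 then (1 : L) else 0)).Local v)]
    (hns : ∀ w : PlacesOver L v, IsCMField.complexConj L • w.1 = w.1)
    (hfin2 : ∃ S : Finset (Subgroup ((UnitaryGroup.cmDatum L 2 (Matrix.of fun i j : Fin 2 => if i.val + j.val + 1 = 2 then (1 : L) else 0)).Local v)),
      (∀ T ∈ S, ∃ a₀ : (UnitaryGroup.cmDatum L 2 (Matrix.of fun i j : Fin 2 => if i.val + j.val + 1 = 2 then (1 : L) else 0)).Local v, IsRegularElt (a₀.val : GL (Fin 2) (UnitaryGroup.LocalRing L v)) ∧ T = Subgroup.centralizer ({a₀} : Set ((UnitaryGroup.cmDatum L 2 (Matrix.of fun i j : Fin 2 => if i.val + j.val + 1 = 2 then (1 : L) else 0)).Local v))) ∧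
      ∀ a : (UnitaryGroup.cmDatum L 2 (Matrix.of fun i j : Fin 2 => if i.val + j.val + 1 = 2 then (1 : L) else 0)).Local v, IsRegularElt (a.val : GL (Fin 2) (UnitaryGroup.LocalRing L v)) →
        ∃ T ∈ S, ∃ u : (UnitaryGroup.cmDatum L 2 (Matrix.of fun i j : Fin 2 => if i.val + j.val + 1 = 2 then (1 : L) else 0)).Local v, Subgroup.centralizer ({a} : Set ((UnitaryGroup.cmDatum L 2 (Matrix.of fun i j : Fin 2 => if i.val + j.val + 1 = 2 then (1 : L) else 0)).Local v)) = T.map (MulAut.conj u).toMonoidHom) :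
        ∃ (SH : Finset (Subgroup ((UnitaryGroup.cmDatum L 2 (Matrix.of fun i j : Fin 2 => if i.val + j.val + 1 = 2 then (1 : L) else 0)).Local v ×
        (UnitaryGroup.cmDatum L 1 (Matrix.of fun i j : Fin 1 => if i.val + j.val + 1 = 1 then (1 : L) else 0)).Local v)))
        (μTHf : (T : Subgroup ((UnitaryGroup.cmDatum L 2 (Matrix.of fun i j : Fin 2 => if i.val + j.val + 1 = 2 then (1 : L) else 0)).Local v ×
        (UnitaryGroup.cmDatum L 1 (Matrix.of fun i j : Fin 1 => if i.val + j.val + 1 = 1 then (1 : L) else 0)).Local v)) → Measure ↥T),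
      (∀ T ∈ SH, IsCompact (T : Set ((UnitaryGroup.cmDatum L 2 (Matrix.of fun i j : Fin 2 => if i.val + j.val + 1 = 2 then (1 : L) else 0)).Local v ×
        (UnitaryGroup.cmDatum L 1 (Matrix.of fun i j : Fin 1 => if i.val + j.val + 1 = 1 then (1 : L) else 0)).Local v)) ∧
        (∃ γ₀ : (UnitaryGroup.cmDatum L 2 (Matrix.of fun i j : Fin 2 => if i.val + j.val + 1 = 2 then (1 : L) else 0)).Local v ×
        (UnitaryGroup.cmDatum L 1 (Matrix.of fun i j : Fin 1 => if i.val + j.val + 1 = 1 then (1 : L) else 0)).Local v, IsLocalGRegular L v γ₀ ∧ T = Subgroup.centralizer ({γ₀} : Set ((UnitaryGroup.cmDatum L 2 (Matrix.of fun i j : Fin 2 => if i.val + j.val + 1 = 2 then (1 : L) else 0)).Local v ×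
        (UnitaryGroup.cmDatum L 1 (Matrix.of fun i j : Fin 1 => if i.val + j.val + 1 = 1 then (1 : L) else 0)).Local v))) ∧
        (μTHf T).IsHaarMeasure ∧ IsProbabilityMeasure (μTHf T)) ∧
      (∀ γ₀ : (UnitaryGroup.cmDatum L 2 (Matrix.of fun i j : Fin 2 => if i.val + j.val + 1 = 2 then (1 : L) else 0)).Local v ×
        (UnitaryGroup.cmDatum L 1 (Matrix.of fun i j : Fin 1 => if i.val + j.val + 1 = 1 then (1 : L) else 0)).Local v, IsLocalGRegular L v γ₀ →
        IsCompact ((Subgroup.centralizer ({γ₀} : Set ((UnitaryGroup.cmDatum L 2 (Matrix.of fun i j : Fin 2 => if i.val + j.val + 1 = 2 then (1 : L) else 0)).Local v ×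
        (UnitaryGroup.cmDatum L 1 (Matrix.of fun i j : Fin 1 => if i.val + j.val + 1 = 1 then (1 : L) else 0)).Local v)) :
            Subgroup ((UnitaryGroup.cmDatum L 2 (Matrix.of fun i j : Fin 2 => if i.val + j.val + 1 = 2 then (1 : L) else 0)).Local v ×
        (UnitaryGroup.cmDatum L 1 (Matrix.of fun i j : Fin 1 => if i.val + j.val + 1 = 1 then (1 : L) else 0)).Local v)) :
          Set ((UnitaryGroup.cmDatum L 2 (Matrix.of fun i j : Fin 2 => if i.val + j.val + 1 = 2 then (1 : L) else 0)).Local v ×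
        (UnitaryGroup.cmDatum L 1 (Matrix.of fun i j : Fin 1 => if i.val + j.val + 1 = 1 then (1 : L) else 0)).Local v)) →
        ∃ T ∈ SH, ∃ x : (UnitaryGroup.cmDatum L 2 (Matrix.of fun i j : Fin 2 => if i.val + j.val + 1 = 2 then (1 : L) else 0)).Local v ×
        (UnitaryGroup.cmDatum L 1 (Matrix.of fun i j : Fin 1 => if i.val + j.val + 1 = 1 then (1 : L) else 0)).Local v,
          Subgroup.centralizer ({x * γ₀ * x⁻¹} : Set ((UnitaryGroup.cmDatum L 2 (Matrix.of fun i j : Fin 2 => if i.val + j.val + 1 = 2 then (1 : L) else 0)).Local v ×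
        (UnitaryGroup.cmDatum L 1 (Matrix.of fun i j : Fin 1 => if i.val + j.val + 1 = 1 then (1 : L) else 0)).Local v)) = T) ∧
      (∀ T ∈ SH, ∀ T' ∈ SH, (∃ x : (UnitaryGroup.cmDatum L 2 (Matrix.of fun i j : Fin 2 => if i.val + j.val + 1 = 2 then (1 : L) else 0)).Local v ×
        (UnitaryGroup.cmDatum L 1 (Matrix.of fun i j : Fin 1 => if i.val + j.val + 1 = 1 then (1 : L) else 0)).Local v, T.map (MulAut.conj x).toMonoidHom = T') → T = T') := by
  have hcomm : ∀ a b : (UnitaryGroup.cmDatum L 1 (Matrix.of fun i j : Fin 1 => if i.val + j.val + 1 = 1 then (1 : L) else 0)).Local v, a * b = b * a := by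
    intro a b
    apply Subtype.ext
    apply Units.ext
    change (a.val : GL (Fin 1) (UnitaryGroup.LocalRing L v)).val * (b.val : GL (Fin 1) (UnitaryGroup.LocalRing L v)).val =
      (b.val : GL (Fin 1) (UnitaryGroup.LocalRing L v)).val * (a.val : GL (Fin 1) (UnitaryGroup.LocalRing L v)).val
    ext i j
    obtain rfl : i = 0 := Subsingleton.elim _ _
    obtain rfl : j = 0 := Subsingleton.elim _ _
    simp only [Matrix.mul_apply, Fin.sum_univ_one]
    exact mul_comm _ _
  obtain ⟨w⟩ : Nonempty (PlacesOver L v) := inferInstance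
  haveI : CompactSpace ((UnitaryGroup.cmDatum L 1 (Matrix.of fun i j : Fin 1 => if i.val + j.val + 1 = 1 then (1 : L) else 0)).Local v) := compactSpace_cmDatum_local_one_of_smul_eq L v w (hns w)
  exact exists_cartanEll_prod_of_cartanEll_haar (A := (UnitaryGroup.cmDatum L 2 (Matrix.of fun i j : Fin 2 => if i.val + j.val + 1 = 2 then (1 : L) else 0)).Local v) (B := (UnitaryGroup.cmDatum L 1 (Matrix.of fun i j : Fin 1 => if i.val + j.val + 1 = 1 then (1 : L) else 0)).Local v) hcomm
    (RegA := fun a => IsRegularElt (a.val : GL (Fin 2) (UnitaryGroup.LocalRing L v))) (Reg := IsLocalGRegular L v)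
    (fun γ hγ => (isRegularElt_fst_snd_of_isLocalGRegular L v γ hγ).1) (exists_isLocalGRegular L v hns) (exists_cartanEll_of_finite_classes hfin2)

end Summit.HodgeConjecture.HodgeConjecture.Cruxes.H413.F0P3cStCharTSCartanEllH

end
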